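import Mathlib
import HarnessLib

/-!
# Stub `stub_residualIrreducibility` of crux `TensorSquareParallel` (stmt-Langlands-17009), helper 1:
# rank-one `2 × 2` matrices and the determinant pairing on `M₂(k)`

Elementary linear algebra on `M₂(k)` used by the tensor-product irreducibility criterion
(`StubResidualIrreducibilityTensor`): the action `X ↦ A X Bᵀ` of a pair `(A, B)` on `M₂(k)` is
the tensor product `k² ⊗ k²` of the standard representations, rank-one matrices `v wᵀ`
(`Matrix.vecMulVec`) are the pure tensors, and the polarised determinant
`B(X, Y) = tr X tr Y − tr(XY) = tr(X · adj Y)` (`exists_pairing`; used as a hypothesis on `B`, no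
definition is introduced) is a non-degenerate symmetric bilinear form with
`B(X, X) = 2 det X` and `B(A X A'ᵀ, A Y A'ᵀ) = det A · det A' · B(X, Y)` (the tensor product of the two
symplectic forms `k² × k² → det`).  Everything here is folklore matrix algebra.

## References

* [Calegari2010] F. Calegari, *Even Galois representations and the Fontaine–Mazur conjecture*,
  Invent. Math. 185 (2011), §2 ("the tensor representation") — the application.
* N. Bourbaki, *Algèbre* IX, §1 (bilinear forms; orthogonality).
-/

set_option linter.dupNamespace false

noncomputable section

namespace Summit.Langlands.Langlands.Theorems.TensorSquareParallel

open scoped MatrixGroups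
open Matrix Module

variable {k : Type*} [Field k]

/-! ## Vectors and rank-one matrices in dimension `2` -/

/-- Two vectors of `k²` with vanishing `2 × 2` determinant are proportional (the first being
non-zero). [folklore] -/
theorem mem_span_of_det_two_eq_zero {v v' : Fin 2 → k} (hv : v ≠ 0)
    (h : v 0 * v' 1 - v 1 * v' 0 = 0) : v' ∈ k ∙ v := by
  rw [Submodule.mem_span_singleton]
  by_cases h0 : v 0 = 0
  · have h1 : v 1 ≠ 0 := by
      intro h1; apply hv; ext i; fin_cases i <;> simp [h0, h1]
    have h' : v' 0 = 0 := by
      have : v 1 * v' 0 = 0 := by rw [h0, zero_mul, zero_sub, neg_eq_zero] at h; exact h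
      exact (mul_eq_zero.mp this).resolve_left h1
    refine ⟨v' 1 / v 1, ?_⟩
    ext i; fin_cases i
    · simp [h0, h']
    · simp [div_mul_cancel₀ _ h1]
  · refine ⟨v' 0 / v 0, ?_⟩
    ext i; fin_cases i
    · simp [div_mul_cancel₀ _ h0]
    · simp only [Fin.mk_one, Fin.isValue, Pi.smul_apply, smul_eq_mul]
      rw [div_mul_eq_mul_div, div_eq_iff h0]
      linear_combination -h

/-- `v wᵀ ≠ 0` for `v, w ≠ 0`. [folklore] -/
theorem vecMulVec_ne_zero {m n : Type*} {v : m → k} {w : n → k} (hv : v ≠ 0) (hw : w ≠ 0) :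
    vecMulVec v w ≠ 0 := by
  obtain ⟨i, hi⟩ := Function.ne_iff.mp hv
  obtain ⟨j, hj⟩ := Function.ne_iff.mp hw
  intro h
  have := congr_fun (congr_fun h i) j
  rw [vecMulVec_apply, Matrix.zero_apply] at this
  exact mul_ne_zero hi hj this

/-- `A (v wᵀ) Bᵀ = (A v)(B w)ᵀ`: pure tensors go to pure tensors. [folklore] -/
theorem mul_vecMulVec_mul_transpose {m n : Type*} [Fintype m] [Fintype n]
    (A : Matrix m m k) (B : Matrix n n k) (v : m → k) (w : n → k) :
    A * vecMulVec v w * Bᵀ = vecMulVec (A *ᵥ v) (B *ᵥ w) := by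
  ext i j
  rw [Matrix.mul_assoc]
  simp only [Matrix.mul_apply, Matrix.transpose_apply, vecMulVec_apply, Matrix.mulVec,
    dotProduct]
  rw [Finset.sum_mul_sum]
  simp only [Finset.mul_sum]
  apply Finset.sum_congr rfl
  intro x _
  apply Finset.sum_congr rfl
  intro y _
  ring

/-- If `v' w'ᵀ` is a multiple of `v wᵀ` and `v', w' ≠ 0`, then `v' ∈ k v` and `w' ∈ k w`.
[folklore] -/
theorem mem_span_of_vecMulVec_mem_span {m n : Type*} {v v' : m → k} {w w' : n → k}
    (h : vecMulVec v' w' ∈ k ∙ vecMulVec v w) (hv' : v' ≠ 0) (hw' : w' ≠ 0) :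
    v' ∈ k ∙ v ∧ w' ∈ k ∙ w := by
  obtain ⟨c, hc⟩ := Submodule.mem_span_singleton.mp h
  have hc' : ∀ i j, v' i * w' j = c * (v i * w j) := fun i j => by
    have := congr_fun (congr_fun hc i) j
    rw [Matrix.smul_apply, vecMulVec_apply, vecMulVec_apply, smul_eq_mul] at this
    exact this.symm
  obtain ⟨i₀, hi₀⟩ := Function.ne_iff.mp hv'
  obtain ⟨j₀, hj₀⟩ := Function.ne_iff.mp hw'
  replace hi₀ : v' i₀ ≠ 0 := hi₀
  replace hj₀ : w' j₀ ≠ 0 := hj₀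
  constructor
  · refine Submodule.mem_span_singleton.mpr ⟨c * w j₀ / w' j₀, funext fun i => ?_⟩
    rw [Pi.smul_apply, smul_eq_mul, div_mul_eq_mul_div, div_eq_iff hj₀]
    linear_combination (hc' i j₀).symm
  · refine Submodule.mem_span_singleton.mpr ⟨c * v i₀ / v' i₀, funext fun j => ?_⟩
    rw [Pi.smul_apply, smul_eq_mul, div_mul_eq_mul_div, div_eq_iff hi₀]
    linear_combination (hc' i₀ j).symm

/-- A non-zero singular `2 × 2` matrix is a pure tensor `v wᵀ` with `v, w ≠ 0`. [folklore] -/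
theorem exists_eq_vecMulVec_of_det_eq_zero {X : Matrix (Fin 2) (Fin 2) k} (hX : X ≠ 0)
    (hdet : X.det = 0) : ∃ v w : Fin 2 → k, v ≠ 0 ∧ w ≠ 0 ∧ X = vecMulVec v w := by
  rw [Matrix.det_fin_two] at hdet
  -- the columns of `X`
  set c₀ : Fin 2 → k := fun i => X i 0 with hc₀
  set c₁ : Fin 2 → k := fun i => X i 1 with hc₁
  by_cases h0 : c₀ = 0
  · have h00 : X 0 0 = 0 := congr_fun h0 0
    have h10 : X 1 0 = 0 := congr_fun h0 1
    have hc₁0 : c₁ ≠ 0 := by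
      intro h1
      apply hX; ext i j; fin_cases i <;> fin_cases j
      · exact h00
      · exact congr_fun h1 0
      · exact h10
      · exact congr_fun h1 1
    refine ⟨c₁, ![0, 1], hc₁0, by simp, ?_⟩
    ext i j; fin_cases i <;> fin_cases j <;> simp [vecMulVec_apply, h00, h10, hc₁]
  · -- the second column is a multiple of the first
    have hmem : c₁ ∈ k ∙ c₀ :=
      mem_span_of_det_two_eq_zero h0 (by simp only [hc₀, hc₁]; linear_combination hdet)
    obtain ⟨t, ht⟩ := Submodule.mem_span_singleton.mp hmem
    refine ⟨c₀, ![1, t], h0, by simp, ?_⟩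
    have ht0 : X 0 1 = t * X 0 0 := by simpa [hc₀, hc₁] using (congr_fun ht 0).symm
    have ht1 : X 1 1 = t * X 1 0 := by simpa [hc₀, hc₁] using (congr_fun ht 1).symm
    ext i j; fin_cases i <;> fin_cases j <;>
      simp [vecMulVec_apply, hc₀, ht0, ht1, mul_comm]

/-! ## The determinant pairing on `M₂(k)` -/

/-- **The determinant pairing exists as a bilinear form**: there is a bilinear form `B` on
`M₂(k)` with `B(X, Y) = X₀₀Y₁₁ − X₀₁Y₁₀ − X₁₀Y₀₁ + X₁₁Y₀₀ = tr X · tr Y − tr(XY) = tr(X · adj Y)`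
(the polarised determinant: `det(X + Y) = det X + B(X, Y) + det Y`).  All further lemmas take
such a `B` as an argument (no definition is introduced). [folklore] -/
theorem exists_pairing : ∃ B : LinearMap.BilinForm k (Matrix (Fin 2) (Fin 2) k),
    ∀ X Y, B X Y = X 0 0 * Y 1 1 - X 0 1 * Y 1 0 - X 1 0 * Y 0 1 + X 1 1 * Y 0 0 := by
  refine ⟨(LinearMap.mul k k).compl₁₂ (Matrix.traceLinearMap (Fin 2) k k)
      (Matrix.traceLinearMap (Fin 2) k k) -
    (LinearMap.mul k (Matrix (Fin 2) (Fin 2) k)).compr₂ (Matrix.traceLinearMap (Fin 2) k k),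
    fun X Y => ?_⟩
  simp only [LinearMap.sub_apply, LinearMap.compl₁₂_apply, LinearMap.compr₂_apply,
    LinearMap.mul_apply', Matrix.traceLinearMap_apply, Matrix.trace, Matrix.diag_apply,
    Fin.sum_univ_two, Matrix.mul_apply]
  ring

variable {B : LinearMap.BilinForm k (Matrix (Fin 2) (Fin 2) k)}
  (hB : ∀ X Y, B X Y = X 0 0 * Y 1 1 - X 0 1 * Y 1 0 - X 1 0 * Y 0 1 + X 1 1 * Y 0 0)
include hB

/-- The pairing is symmetric. [folklore] -/
theorem pairing_comm (X Y : Matrix (Fin 2) (Fin 2) k) : B X Y = B Y X := by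
  rw [hB, hB]; ring

/-- The pairing is reflexive (being symmetric). [folklore] -/
theorem pairing_isRefl : B.IsRefl := fun X Y h => by
  rw [pairing_comm hB]; exact h

/-- `B(X, X) = 2 det X`. [folklore] -/
theorem pairing_self (X : Matrix (Fin 2) (Fin 2) k) : B X X = 2 * X.det := by
  rw [hB, Matrix.det_fin_two]; ring

/-- **Invariance**: `B(A X Bᵀ, A Y Bᵀ) = det A · det B · B(X, Y)` — the pair `(A, B)` acts on
`M₂(k) = k² ⊗ k²` by similitudes of the pairing. [folklore] -/
theorem pairing_conj (A A' X Y : Matrix (Fin 2) (Fin 2) k) :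
    B (A * X * A'ᵀ) (A * Y * A'ᵀ) = A.det * A'.det * B X Y := by
  simp only [hB, Matrix.mul_apply, Matrix.transpose_apply, Fin.sum_univ_two, Matrix.det_fin_two]
  ring

/-- The pairing of two pure tensors factors: `B(v wᵀ, v' w'ᵀ) = det(v, v') · det(w, w')`.
[folklore] -/
theorem pairing_vecMulVec (v w v' w' : Fin 2 → k) :
    B (vecMulVec v w) (vecMulVec v' w') =
      (v 0 * v' 1 - v 1 * v' 0) * (w 0 * w' 1 - w 1 * w' 0) := by
  simp only [hB, vecMulVec_apply]
  ring

/-- The pairing is non-degenerate. [folklore] -/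
theorem pairing_nondegenerate : B.Nondegenerate := by
  refine (pairing_isRefl hB : LinearMap.IsRefl B).nondegenerate_iff_separatingLeft.mpr
    fun X hX => ?_
  have h11 := hX (Matrix.of ![![0, 0], ![0, 1]])
  have h10 := hX (Matrix.of ![![0, 0], ![1, 0]])
  have h01 := hX (Matrix.of ![![0, 1], ![0, 0]])
  have h00 := hX (Matrix.of ![![1, 0], ![0, 0]])
  rw [hB] at h11 h10 h01 h00
  simp at h11 h10 h01 h00
  ext i j; fin_cases i <;> fin_cases j
  · exact h11
  · exact h10
  · exact h01
  · exact h00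

omit hB

/-- **The determinant pairing, packaged** (the registered sub-goal this helper file proves):
on `M₂(k)` there is a non-degenerate reflexive (indeed symmetric) bilinear form `B` with
`B(X, X) = 2 det X`, `B(A X A'ᵀ, A Y A'ᵀ) = det A · det A' · B(X, Y)` and
`B(v wᵀ, v' w'ᵀ) = det(v, v') det(w, w')` — the tensor product of the two symplectic forms on
`k²`, for which the pair `(A, A')` acts by similitudes. [folklore] -/
theorem stub_residualIrreducibility_pairing : ∀ (k : Type) [Field k], ∃ B : LinearMap.BilinForm k (Matrix (Fin 2) (Fin 2) k), B.Nondegenerate ∧ B.IsRefl ∧ (∀ X : Matrix (Fin 2) (Fin 2) k, B X X = 2 * X.det) ∧ (∀ A A' X Y : Matrix (Fin 2) (Fin 2) k, B (A * X * A'.transpose) (A * Y * A'.transpose) = A.det * A'.det * B X Y) ∧ (∀ v w v' w' : Fin 2 → k, B (Matrix.vecMulVec v w) (Matrix.vecMulVec v' w') = (v 0 * v' 1 - v 1 * v' 0) * (w 0 * w' 1 - w 1 * w' 0)) := by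
  intro k _
  obtain ⟨B, hB⟩ := exists_pairing (k := k)
  exact ⟨B, pairing_nondegenerate hB, pairing_isRefl hB, pairing_self hB, pairing_conj hB,
    pairing_vecMulVec hB⟩

/-- `dim_k M₂(k) = 4`. [folklore] -/
theorem finrank_matrix_two : finrank k (Matrix (Fin 2) (Fin 2) k) = 4 := by
  rw [Module.finrank_matrix]; simp

/-- `dim W^⊥ = 4 − dim W` for a non-degenerate bilinear form on `M₂(k)`. [folklore] -/
theorem finrank_orthogonal_of_nondegenerate {B : LinearMap.BilinForm k (Matrix (Fin 2) (Fin 2) k)}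
    (hnd : B.Nondegenerate) (W : Submodule k (Matrix (Fin 2) (Fin 2) k)) :
    finrank k (B.orthogonal W) = 4 - finrank k W := by
  rw [LinearMap.BilinForm.finrank_orthogonal hnd, finrank_matrix_two]

/-- **The orthogonal of a stable subspace is stable**: for a reflexive form `B` on `M₂(k)` for
which pairs act by similitudes, if `W ⊆ M₂(k)` is stable under the inverse pair
`X ↦ A⁻¹ X A'⁻ᵀ` of an invertible pair `(A, A')`, then `W^⊥` is stable under `X ↦ A X A'ᵀ`.
[folklore] -/
theorem conj_mem_orthogonal {B : LinearMap.BilinForm k (Matrix (Fin 2) (Fin 2) k)}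
    (hrefl : B.IsRefl)
    (hconj : ∀ A A' X Y : Matrix (Fin 2) (Fin 2) k,
      B (A * X * A'.transpose) (A * Y * A'.transpose) = A.det * A'.det * B X Y)
    {W : Submodule k (Matrix (Fin 2) (Fin 2) k)} {A A' : GL (Fin 2) k}
    (hinv : ∀ X ∈ W, ((A⁻¹ : GL (Fin 2) k) : Matrix (Fin 2) (Fin 2) k) * X *
      (((A'⁻¹ : GL (Fin 2) k) : Matrix (Fin 2) (Fin 2) k))ᵀ ∈ W)
    {X : Matrix (Fin 2) (Fin 2) k} (hX : X ∈ B.orthogonal W) :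
    (A : Matrix (Fin 2) (Fin 2) k) * X * ((A' : GL (Fin 2) k) : Matrix (Fin 2) (Fin 2) k)ᵀ ∈
      B.orthogonal W := by
  rw [LinearMap.BilinForm.mem_orthogonal_iff] at hX ⊢
  intro Y hY
  -- `Y = A (A⁻¹ Y A'⁻ᵀ) A'ᵀ`
  have hY' : B ((((A⁻¹ : GL (Fin 2) k) : Matrix (Fin 2) (Fin 2) k) * Y *
      (((A'⁻¹ : GL (Fin 2) k) : Matrix (Fin 2) (Fin 2) k))ᵀ)) X = 0 := hX _ (hinv Y hY)
  have e : Y = (A : Matrix (Fin 2) (Fin 2) k) *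
      (((A⁻¹ : GL (Fin 2) k) : Matrix (Fin 2) (Fin 2) k) * Y *
        (((A'⁻¹ : GL (Fin 2) k) : Matrix (Fin 2) (Fin 2) k))ᵀ) *
      ((A' : GL (Fin 2) k) : Matrix (Fin 2) (Fin 2) k)ᵀ := by
    rw [Matrix.coe_units_inv, Matrix.coe_units_inv, ← Matrix.mul_assoc, ← Matrix.mul_assoc,
      Matrix.mul_nonsing_inv _ (Matrix.isUnits_det_units A), Matrix.one_mul, Matrix.mul_assoc,
      ← Matrix.transpose_mul, Matrix.mul_nonsing_inv _ (Matrix.isUnits_det_units A'),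
      Matrix.transpose_one, Matrix.mul_one]
  change B Y _ = 0
  refine hrefl _ _ ?_
  rw [e, hconj, hrefl _ _ hY', mul_zero]

/-! ## One-dimensional subspaces and scalar intertwiners -/

/-- A subspace of dimension `1` is the line spanned by any of its non-zero vectors; in
particular it is `k X₀` for some `X₀ ≠ 0`. [folklore] -/
theorem exists_eq_span_singleton_of_finrank_eq_one {M : Type*} [AddCommGroup M] [Module k M]
    (W : Submodule k M) (h : finrank k W = 1) : ∃ X₀ : M, X₀ ≠ 0 ∧ W = k ∙ X₀ := by
  obtain ⟨v, hv, hall⟩ := finrank_eq_one_iff'.mp h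
  refine ⟨v, fun h0 => hv (Subtype.ext h0), le_antisymm (fun w hw => ?_) ?_⟩
  · obtain ⟨c, hc⟩ := hall ⟨w, hw⟩
    exact Submodule.mem_span_singleton.mpr ⟨c, by simpa using congrArg Subtype.val hc⟩
  · exact (Submodule.span_singleton_le_iff_mem _ _).mpr v.2

variable {Λ : Type*} [Group Λ] {n : Type*} [Fintype n] [DecidableEq n] [Nonempty n]

/-- **Scalar intertwiners form a character.**  If `V'(λ) = c_λ · P V(λ) P⁻¹` for SOME scalar
`c_λ` at each `λ`, then `λ ↦ c_λ` is a well-defined homomorphism `χ : Λ → kˣ` with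
`V' = χ ⊗ (P V P⁻¹)`. [folklore] -/
theorem exists_character_of_forall_exists_smul (V V' : Λ →* GL n k) (P : GL n k)
    (h : ∀ x, ∃ c : k, ((V' x : GL n k) : Matrix n n k) =
      c • (((P * V x * P⁻¹ : GL n k) : GL n k) : Matrix n n k)) :
    ∃ χ : Λ →* kˣ, ∀ x, ((V' x : GL n k) : Matrix n n k) =
      (χ x : k) • (((P * V x * P⁻¹ : GL n k) : GL n k) : Matrix n n k) := by
  choose c hc using h
  -- each `c x` is non-zero
  have hc0 : ∀ x, c x ≠ 0 := fun x h0 => by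
    have := hc x
    rw [h0, zero_smul] at this
    have hdet : ((V' x : GL n k) : Matrix n n k).det = 0 := by rw [this, Matrix.det_zero]
    exact (Matrix.isUnits_det_units (V' x)).ne_zero hdet
  have hQ : ∀ x y, (P * V (x * y) * P⁻¹ : GL n k) = (P * V x * P⁻¹) * (P * V y * P⁻¹) := by
    intro x y; rw [map_mul]; group
  -- multiplicativity
  have hmul : ∀ x y, c (x * y) = c x * c y := fun x y => by
    have e1 := hc (x * y)
    have e2 : ((V' (x * y) : GL n k) : Matrix n n k) =
        (c x * c y) • (((P * V (x * y) * P⁻¹ : GL n k) : GL n k) : Matrix n n k) := by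
      rw [map_mul V' x y, Units.val_mul (V' x) (V' y), hc x, hc y, Matrix.smul_mul,
        Matrix.mul_smul, smul_smul, hQ x y, Units.val_mul (P * V x * P⁻¹) (P * V y * P⁻¹)]
    have e3 : (c (x * y) - c x * c y) •
        (((P * V (x * y) * P⁻¹ : GL n k) : GL n k) : Matrix n n k) = 0 := by
      rw [sub_smul, ← e1, ← e2, sub_self]
    rcases smul_eq_zero.mp e3 with h0 | h0
    · exact sub_eq_zero.mp h0
    · exfalso
      have hdet := congrArg Matrix.det h0
      rw [Matrix.det_zero] at hdet
      exact (Matrix.isUnits_det_units _).ne_zero hdet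
  have hone : c 1 = 1 := by
    have h11 := hmul 1 1
    rw [mul_one] at h11
    exact mul_left_cancel₀ (hc0 1) (h11.symm.trans (mul_one (c 1)).symm)
  refine ⟨{ toFun := fun x => Units.mk0 (c x) (hc0 x),
            map_one' := Units.ext (by simpa using hone),
            map_mul' := fun x y => Units.ext (by simp [hmul]) }, fun x => ?_⟩
  exact hc x

end Summit.Langlands.Langlands.Theorems.TensorSquareParallel

end
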